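import Summits.Ventures.PercRepro2.TypedCountMonotoneNeg

/-!
# The typed point-split count is NEGATIVE on `K_{2,5}`
(blind cell PercRepro2, night-3 g26, 2026-08-29; `proofs/NIGHT3-CERT.md` §35.8)

The statement of record of the line since §32.18 — `T(H; s, v; f, g) ≥ 0` for every multigraph and
all increasing `f, g` (`T = Σ_{A : v ∈ R_A} (f(R_A) − f(B_A))(g(R_A) − g(B_A))`, the two-copy
Bernstein coefficient of the point-split form (PS1)) — is **false at `n = 7`**: on the complete
bipartite graph `K_{2,5}` with parts `{s, v} = {0, 1}` and `{2, 3, 4, 5, 6}` (ten edges, five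
internally disjoint routes of length two between `s` and `v`) and the principal functionals
`f = [{2, 6} ⊆ ·]`, `g = [{3, 4, 5} ⊆ ·]`, the count is `T = −3` (187 terms `+1`, 190 terms `−1`).
Found by the exact tensor-cone census of the 2-connected class at `n = 7` (kit j327717: the LP is
infeasible on six of the 1,868 classes, all with `s` adjacent to every non-`v` vertex), located by
an exact alternating minimisation over up-sets of the cluster poset, re-checked by two independent
exact computations and here by the kernel (`decide +kernel` on the bitmask model, 1,024
colourings).  Every exhaustive census of the cell stopped at `n ≤ 6` (`K_{2,4}` has `T ≥ 0`).
Own work; standard axioms.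
-/

namespace Summit.Ventures.PercRepro2

namespace TypedCert

/-- `T(K_{2,5}) = −3` for `f = [{2, 6} ⊆ ·]` (mask `68`) and `g = [{3, 4, 5} ⊆ ·]` (mask `56`). -/
theorem Tform_K25_eq_neg_three :
    Tform [(0, 2), (0, 3), (0, 4), (0, 5), (0, 6), (1, 2), (1, 3), (1, 4), (1, 5), (1, 6)] 0 1
      (fun X : Nat => if X &&& 68 = 68 then (1 : ℚ) else 0)
      (fun X : Nat => if X &&& 56 = 56 then (1 : ℚ) else 0) = -3 := by
  decide +kernel

/-- **The typed point-split count can be negative**: on `K_{2,5}` there are mask-monotone `f, g`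
with `T < 0`. -/
theorem exists_Tform_neg :
    ∃ f g : Nat → ℚ, MonoMask f ∧ MonoMask g ∧
      Tform [(0, 2), (0, 3), (0, 4), (0, 5), (0, 6), (1, 2), (1, 3), (1, 4), (1, 5), (1, 6)] 0 1
        f g < 0 :=
  ⟨_, _, monoMask_indicator_subset' 68, monoMask_indicator_subset' 56, by
    rw [Tform_K25_eq_neg_three]; norm_num⟩

end TypedCert

end Summit.Ventures.PercRepro2
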